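import Literature.Computability.Complexity.CodeFP
import Mathlib.Algebra.BigOperators.Ring.Finset
import HarnessLib

/-!
# A kernel test over `GF(2)` as a functional program, and its polynomial-time realisation on codes

Support file (theorems and definitions with bodies only) for the discharge of
`Literature.Computability.Complexity.fortnowGrochow_Ker_eq_PEq_UP_subset_BQP` (Fortnow–Grochow 2011,
Thm. 4.3, through Simon's algorithm): the classical post-processing of Simon's algorithm decides
whether the sampled vectors `ξ₁, …, ξ_m ∈ {0,1}^Q` admit a nonzero `s` with `ξ_i · s = 0` for all `i`
(Simon 1997, §3.1: the samples "do not contain a basis"), i.e. whether a matrix over `GF(2)` given by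
its rows has a nonzero kernel vector. This is Gaussian elimination; the tree's
`LinearAlgebra/Matrix/ListKernel.lean` has the column-elimination program over a field returning a
kernel vector, without a polynomial-time realisation. Here, over `GF(2)` and for the DECISION only:

* `dotB` (the dot product of bit lists = parity of the overlap; `dotB_ofFn`), `elimRow`, `pivot`,
  **`hasKer n rows`** (column elimination: no row with a leading `1` ⟹ `e₀` is a kernel vector;
  otherwise eliminate the first column with the first such row and recurse; no column left ⟹ none)
  and its correctness **`hasKer_iff`**: `hasKer n rows ↔ HasKernel n rows` on rows of length `n`
  (`HasKernel`: some nonzero `v ∈ {0,1}^n` with `r · v = 0` for every row); on vectors,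
  `hasKernel_ofFn_iff` (some nonzero `s` has even overlap with every row);
* the same as a loop with a state (`pivotPair`, `stepK`, `finalK_iterate_stepK`, `progK`,
  `progK_eq_true_iff`), and **`progKCode : CodeFP rowsE bitE progK`** — the program runs in
  polynomial time on the codes `rawE (rawE bitE)` of row lists, assembled from the typed combinators
  of `CodeFP.lean` (`foldl` with the accumulator bound "elimination does not lengthen the rows",
  `map`, `zipWith`, `rawCases`, `ite`); no machine is written.

## References

* D. E. Knuth, *The Art of Computer Programming*, Vol. 2, 3rd ed., Addison–Wesley 1998, §4.6.2,
  Algorithm N (null space by column elimination) [KnuthTAOCP2]. Cited for the algorithm; everything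
  is proved here.
* D. R. Simon, *On the power of quantum computation*, SIAM J. Comput. 26 (1997), §3.1 [Simon1997].
* S. Arora, B. Barak, *Computational Complexity: A Modern Approach*, CUP 2009, §1.3 (polynomial
  time is closed under composition and bounded loops) [AroraBarak2009].
-/

namespace Literature.Computability.Complexity

namespace GF2Kernel

open Finset

/-! ### The dot product and the program -/

/-- **The dot product over `GF(2)`** of two bit lists (truncating): the parity of the overlap. [folklore] -/
def dotB : List Bool → List Bool → Bool
  | a :: l, b :: l' => xor (a && b) (dotB l l')
  | _, _ => false

/-- `dotB` of two conses. [folklore] -/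
@[simp] theorem dotB_cons_cons (a b : Bool) (l l' : List Bool) : dotB (a :: l) (b :: l') = xor (a && b) (dotB l l') := rfl

/-- `dotB` with the empty list. [folklore] -/
@[simp] theorem dotB_nil_left (l : List Bool) : dotB [] l = false := by cases l <;> rfl

/-- `dotB` with the empty list. [folklore] -/
@[simp] theorem dotB_nil_right (l : List Bool) : dotB l [] = false := by cases l <;> rfl

/-- `dotB` against zeros vanishes. [folklore] -/
theorem dotB_replicate_false (l : List Bool) : ∀ n, dotB l (List.replicate n false) = false := by
  induction l with
  | nil => simp
  | cons a l ih => intro n; cases n <;> simp [List.replicate_succ, ih]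

/-- `dotB` is additive in its first argument (equal lengths). [folklore] -/
theorem dotB_zipWith_xor : ∀ (p q v : List Bool), p.length = q.length →
    dotB (List.zipWith xor p q) v = xor (dotB p v) (dotB q v)
  | [], [], v, _ => by simp
  | a :: p, b :: q, [], _ => by simp
  | a :: p, b :: q, c :: v, h => by
    rw [List.zipWith_cons_cons, dotB_cons_cons, dotB_cons_cons, dotB_cons_cons, dotB_zipWith_xor p q v (by simpa using h)]
    cases a <;> cases b <;> cases c <;> cases dotB p v <;> cases dotB q v <;> rfl
  | [], _ :: _, _, h => by simp at h
  | _ :: _, [], _, h => by simp at h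

/-- **Elimination of the first column by the pivot row `p`** (`p₀ = 1`): `r ↦ (r ⊕ [r₀] p)` minus its
first entry. [cite: KnuthTAOCP2, §4.6.2, Algorithm N] -/
def elimRow (p r : List Bool) : List Bool := if r.headD false then (List.zipWith xor r p).tail else r.tail

/-- The pivot: the first row with a nonzero first entry. [folklore] -/
def pivot (rows : List (List Bool)) : Option (List Bool) := rows.find? fun r => r.headD false

/-- **The kernel test**: is there a nonzero vector orthogonal to all rows? By column elimination:
if no row has a nonzero first entry, `e₀` is such a vector; otherwise eliminate the first column with
the first such row and recurse on the remaining columns; with no column left there is none.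
[cite: KnuthTAOCP2, §4.6.2, Algorithm N (null space by column elimination)] -/
def hasKer : ℕ → List (List Bool) → Bool
  | 0, _ => false
  | n + 1, rows =>
    match pivot rows with
    | none => true
    | some p => hasKer n (rows.map (elimRow p))

/-- **The specification**: a nonzero vector of length `n` orthogonal to every row. [folklore] -/
def HasKernel (n : ℕ) (rows : List (List Bool)) : Prop :=
  ∃ v : List Bool, v.length = n ∧ v ≠ List.replicate n false ∧ ∀ r ∈ rows, dotB r v = false

/-- Length of an eliminated row. [folklore] -/
theorem length_elimRow {p r : List Bool} {n : ℕ} (hp : p.length = n + 1) (hr : r.length = n + 1) : (elimRow p r).length = n := by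
  unfold elimRow; split_ifs <;> simp [hp, hr]

/-- **Correctness of the kernel test** on rows of length `n`. [cite: KnuthTAOCP2, §4.6.2, Algorithm N] -/
theorem hasKer_iff : ∀ (n : ℕ) (rows : List (List Bool)), (∀ r ∈ rows, r.length = n) → (hasKer n rows = true ↔ HasKernel n rows)
  | 0, rows, _ => by
    simp only [hasKer, Bool.false_eq_true, false_iff, HasKernel]
    rintro ⟨v, hv, hv0, -⟩
    exact hv0 (List.eq_nil_of_length_eq_zero hv)
  | n + 1, rows, hlen => by
    rw [hasKer]
    cases hpiv : pivot rows with
    | none =>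
      simp only [true_iff]
      refine ⟨true :: List.replicate n false, by simp, by simp [List.replicate_succ], fun r hr => ?_⟩
      obtain ⟨r₀, r', rfl⟩ : ∃ r₀ r', r = r₀ :: r' := by
        rcases r with _ | ⟨r₀, r'⟩
        · have := hlen _ hr; simp at this
        · exact ⟨r₀, r', rfl⟩
      have h0 : r₀ = false := by
        have := List.find?_eq_none.1 hpiv (r₀ :: r') hr
        simpa using this
      subst h0
      simp [dotB_replicate_false]
    | some p =>
      simp only
      have hp : p ∈ rows := List.mem_of_find?_eq_some hpiv
      have hp0 : p.headD false = true := by have := List.find?_some hpiv; simpa using this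
      have hpl : p.length = n + 1 := hlen p hp
      obtain ⟨p₀, p', rfl⟩ : ∃ p₀ p', p = p₀ :: p' := by
        rcases p with _ | ⟨p₀, p'⟩
        · simp at hpl
        · exact ⟨p₀, p', rfl⟩
      simp only [List.headD_cons] at hp0
      subst hp0
      rw [hasKer_iff n _ (fun r' hr' => by
        obtain ⟨r, hr, rfl⟩ := List.mem_map.1 hr'
        exact length_elimRow hpl (hlen r hr))]
      constructor
      · -- from a kernel vector of the eliminated rows to one of the rows
        rintro ⟨v', hv', hv'0, hker⟩
        set v₀ := dotB p' v' with hv₀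
        refine ⟨v₀ :: v', by simp [hv'], fun h => hv'0 (by simpa [List.replicate_succ] using (List.cons_eq_cons.1 h).2), fun r hr => ?_⟩
        have hrl := hlen r hr
        obtain ⟨r₀, r', rfl⟩ : ∃ r₀ r', r = r₀ :: r' := by
          rcases r with _ | ⟨r₀, r'⟩
          · simp at hrl
          · exact ⟨r₀, r', rfl⟩
        have hk := hker (elimRow (true :: p') (r₀ :: r')) (List.mem_map.2 ⟨_, hr, rfl⟩)
        unfold elimRow at hk
        cases r₀ with
        | false => simpa using hk
        | true =>
          simp only [List.headD_cons, if_true, List.zipWith_cons_cons, List.tail_cons] at hk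
          rw [dotB_zipWith_xor _ _ _ (by simp at hrl hpl; omega)] at hk
          rw [dotB_cons_cons, Bool.true_and, hv₀]
          revert hk; cases dotB r' v' <;> cases dotB p' v' <;> simp
      · -- from a kernel vector of the rows to one of the eliminated rows
        rintro ⟨v, hv, hv0, hker⟩
        obtain ⟨v₀, v', rfl⟩ : ∃ v₀ v', v = v₀ :: v' := by
          rcases v with _ | ⟨v₀, v'⟩
          · simp at hv
          · exact ⟨v₀, v', rfl⟩
        have hpv : dotB (true :: p') (v₀ :: v') = false := hker _ hp
        refine ⟨v', by simpa using hv, fun h => ?_, fun r' hr' => ?_⟩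
        · -- `v' = 0` forces `v₀ = 1` and then the pivot is not orthogonal
          subst h
          cases v₀ with
          | false => exact hv0 (by simp [List.replicate_succ])
          | true => simp [dotB_replicate_false] at hpv
        · obtain ⟨r, hr, rfl⟩ := List.mem_map.1 hr'
          have hrl := hlen r hr
          obtain ⟨r₀, r'', rfl⟩ : ∃ r₀ r'', r = r₀ :: r'' := by
            rcases r with _ | ⟨r₀, r''⟩
            · simp at hrl
            · exact ⟨r₀, r'', rfl⟩
          have hrv := hker _ hr
          unfold elimRow
          cases r₀ with
          | false => simpa using hrv
          | true =>
            simp only [List.headD_cons, if_true, List.zipWith_cons_cons, List.tail_cons]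
            rw [dotB_zipWith_xor _ _ _ (by simp at hrl hpl; omega)]
            rw [dotB_cons_cons, Bool.true_and] at hrv hpv
            revert hrv hpv; cases dotB r'' v' <;> cases dotB p' v' <;> cases v₀ <;> simp

/-! ### The dot product on vectors -/

/-- `dotB` of two `ofFn`s is the oddness of the overlap. [folklore] -/
theorem dotB_ofFn {Q : ℕ} (a b : Fin Q → Bool) : dotB (List.ofFn a) (List.ofFn b) = !decide (Even (univ.filter fun i => a i && b i).card) := by
  induction Q with
  | zero => simp
  | succ Q ih =>
    rw [List.ofFn_succ, List.ofFn_succ, dotB_cons_cons, ih, Fin.card_filter_univ_succ']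
    cases a 0 <;> cases b 0 <;> simp
    all_goals
      by_cases h : Even (univ.filter fun x : Fin Q => a x.succ = true ∧ b x.succ = true).card
      · simp [h, Nat.even_add]
      · simp [h, Nat.even_add]

/-- **The specification on vectors**: `HasKernel` of the rows `y c` says that some nonzero `s` has even
overlap with every `y c`. [folklore] -/
theorem hasKernel_ofFn_iff {m Q : ℕ} (y : Fin m → Fin Q → Bool) :
    HasKernel Q (List.ofFn fun c => List.ofFn (y c)) ↔
      ∃ s : Fin Q → Bool, s ≠ (fun _ => false) ∧ ∀ c, Even (univ.filter fun i => s i && y c i).card := by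
  constructor
  · rintro ⟨v, hv, hv0, hker⟩
    refine ⟨fun i => v.get ⟨i, by omega⟩, fun h => hv0 ?_, fun c => ?_⟩
    · apply List.ext_getElem (by simp [hv])
      intro i h₁ h₂
      have := congrFun h ⟨i, by omega⟩
      simp only [List.get_eq_getElem] at this
      rw [this, List.getElem_replicate]
    · have hk := hker (List.ofFn (y c)) (List.mem_ofFn.2 ⟨c, rfl⟩)
      have e : v = List.ofFn (fun i : Fin Q => v.get ⟨i, by omega⟩) := by
        apply List.ext_getElem (by simp [hv]); intro i h₁ h₂; simp
      rw [e, dotB_ofFn] at hk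
      simp only [Bool.not_eq_eq_eq_not] at hk
      simpa [Bool.and_comm] using hk
  · rintro ⟨s, hs, hev⟩
    refine ⟨List.ofFn s, by simp, fun h => hs ?_, fun r hr => ?_⟩
    · funext i
      have := congrArg (fun l : List Bool => l.getD i false) h
      simpa using this
    · obtain ⟨c, rfl⟩ := List.mem_ofFn.1 hr
      rw [dotB_ofFn]
      simpa [Bool.and_comm] using hev c

/-! ### The program as a loop with a state, and its polynomial-time realisation on codes -/

section Program

/-- The pivot search as a left fold: `(found?, pivot)`. [folklore] -/
def pivotStep (r : List Bool) (acc : Bool × List Bool) : Bool × List Bool :=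
  if acc.1 then acc else if r.headD false then (true, r) else (false, [])

/-- The pivot search as a left fold. [folklore] -/
def pivotPair (rows : List (List Bool)) : Bool × List Bool := rows.foldl (fun acc r => pivotStep r acc) (false, [])

/-- A found pivot is kept. [folklore] -/
theorem foldl_pivotStep_true (q : List Bool) : ∀ rows : List (List Bool), rows.foldl (fun acc r => pivotStep r acc) (true, q) = (true, q)
  | [] => rfl
  | r :: rows => by rw [List.foldl_cons, show pivotStep r (true, q) = (true, q) from rfl]; exact foldl_pivotStep_true q rows

/-- **The fold finds the pivot.** [folklore] -/
theorem pivotPair_eq : ∀ rows : List (List Bool),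
    pivotPair rows = match pivot rows with | none => (false, []) | some p => (true, p)
  | [] => rfl
  | r :: rows => by
    rw [pivotPair, List.foldl_cons, pivot, List.find?_cons]
    by_cases hr : r.headD false = true
    · rw [show pivotStep r (false, []) = (true, r) by rw [pivotStep, if_neg Bool.false_ne_true, if_pos hr], foldl_pivotStep_true, hr]
    · rw [Bool.not_eq_true] at hr
      rw [show pivotStep r (false, []) = (false, []) by rw [pivotStep, if_neg Bool.false_ne_true, if_neg (by rw [hr]; exact Bool.false_ne_true)], hr]
      exact pivotPair_eq rows

/-- The state of the loop: the current rows, `done?`, the answer. [folklore] -/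
abbrev KState : Type := List (List Bool) × (Bool × Bool)

/-- **One round**: if not done, eliminate a column or conclude. [cite: KnuthTAOCP2, §4.6.2, Algorithm N] -/
def stepK (st : KState) : KState :=
  if st.2.1 then st else
    if (pivotPair st.1).1 then (st.1.map (elimRow (pivotPair st.1).2), (false, false)) else (st.1, (true, true))

/-- The answer read off a state. [folklore] -/
def finalK (st : KState) : Bool := st.2.1 && st.2.2

/-- A finished state is fixed. [folklore] -/
theorem stepK_done (rows : List (List Bool)) (b : Bool) : stepK (rows, (true, b)) = (rows, (true, b)) := rfl

/-- **`k` rounds of the loop compute `hasKer k`.** [folklore] -/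
theorem finalK_iterate_stepK : ∀ (k : ℕ) (rows : List (List Bool)), finalK (stepK^[k] (rows, (false, false))) = hasKer k rows
  | 0, rows => rfl
  | k + 1, rows => by
    rw [Function.iterate_succ_apply, hasKer]
    have e : stepK (rows, (false, false)) =
        if (pivotPair rows).1 then (rows.map (elimRow (pivotPair rows).2), (false, false)) else (rows, (true, true)) := rfl
    rw [e, pivotPair_eq]
    cases pivot rows with
    | none => simp only [Bool.false_eq_true, ↓reduceIte]; rw [Function.iterate_fixed (stepK_done rows true)]; rfl
    | some p => simp only [↓reduceIte]; exact finalK_iterate_stepK k _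

/-- **The program**: run `|first row|` rounds (the number of columns) from the given rows.
[cite: KnuthTAOCP2, §4.6.2, Algorithm N] -/
def progK (rows : List (List Bool)) : Bool :=
  finalK ((rows.headD []).foldl (fun st _ => stepK st) (rows, (false, false)))

/-- A fold ignoring the items is an iteration. [folklore] -/
theorem foldl_const_eq_iterate {α β : Type} (f : β → β) : ∀ (l : List α) (b : β), l.foldl (fun st _ => f st) b = f^[l.length] b
  | [], b => rfl
  | a :: l, b => by rw [List.foldl_cons, foldl_const_eq_iterate f l, List.length_cons, Function.iterate_succ_apply]

/-- **The program decides `HasKernel`** on nonempty row lists of a common length. [cite: KnuthTAOCP2, §4.6.2, Algorithm N] -/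
theorem progK_eq_true_iff {n : ℕ} {rows : List (List Bool)} (hne : rows ≠ []) (hlen : ∀ r ∈ rows, r.length = n) :
    progK rows = true ↔ HasKernel n rows := by
  obtain ⟨r₀, rows', rfl⟩ : ∃ r₀ rows', rows = r₀ :: rows' := by
    rcases rows with _ | ⟨r₀, rows'⟩
    · exact absurd rfl hne
    · exact ⟨r₀, rows', rfl⟩
  rw [progK, List.headD_cons, foldl_const_eq_iterate, finalK_iterate_stepK, hlen r₀ (by simp)]
  exact hasKer_iff n _ hlen

/-! ### Realisation on codes -/

open CodeFP Polynomial

/-- Code of a row: the raw list of its bits. [folklore] -/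
abbrev rowE : List Bool → List Bool := rawE bitE
/-- Code of a row list. [folklore] -/
abbrev rowsE : List (List Bool) → List Bool := rawE rowE
/-- Code of a state. [folklore] -/
abbrev stE : KState → List Bool := pairE rowsE (pairE bitE bitE)

/-- Xor of two bits on codes. [folklore] -/
theorem xorCode : CodeFP (pairE bitE bitE) bitE (fun p : Bool × Bool => xor p.1 p.2) :=
  (((fst bitE bitE).or (snd bitE bitE)).and (((fst bitE bitE).and (snd bitE bitE)).not)).congr fun p => by
    rcases p with ⟨a, b⟩; cases a <;> cases b <;> rfl

/-- The first bit of a row (default `0`), with a context. [folklore] -/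
theorem headDCode {σ : Type} (eσ : σ → List Bool) : CodeFP (pairE eσ rowE) bitE (fun p => p.2.headD false) :=
  rawCases (k := fun (_ : σ) (l : List Bool) => l.headD false) (const eσ false) ((snd _ _).fst') (fun _ => rfl) (fun _ _ _ => rfl)

/-- **Elimination of a row on codes** (context: the pivot). [folklore] -/
theorem elimRowCode : CodeFP (pairE rowE rowE) rowE (fun t => elimRow t.1 t.2) := by
  have hz : CodeFP (pairE rowE (pairE rowE rowE)) rowE (fun q => List.zipWith (fun a b => xor a b) q.2.1 q.2.2) :=
    (zipWith (g := fun t : List Bool × Bool × Bool => xor t.2.1 t.2.2) (xorCode.comp (snd rowE (pairE bitE bitE)))).congr fun _ => rfl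
  have hh : CodeFP (pairE rowE rowE) bitE (fun t => t.2.headD false) := headDCode rowE
  exact (hh.ite ((rawTail bitE).comp (hz.comp ((fst _ _).pair ((snd _ _).pair (fst _ _))))) ((rawTail bitE).comp (snd _ _))).congr
    fun t => by unfold elimRow; rfl

/-- **Elimination of all rows on codes** (context: the pivot). [folklore] -/
theorem mapElimCode : CodeFP (pairE rowE rowsE) rowsE (fun q => q.2.map (elimRow q.1)) := map elimRowCode

/-- Code length of a raw bit list. [folklore] -/
theorem length_rowE (r : List Bool) : (rowE r).length = 4 * r.length := by
  induction r with
  | nil => rfl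
  | cons b r ih => rw [show rowE (b :: r) = boolPair (bitE b) (rowE r) from rfl, length_boolPair, ih]; simp [bitE]; ring

/-- **The pivot search on codes.** [folklore] -/
theorem pivotPairCode : CodeFP rowsE (pairE bitE rowE) pivotPair := by
  have hh : CodeFP (pairE rowE (pairE bitE rowE)) bitE (fun t => t.1.headD false) :=
    (headDCode (pairE bitE rowE)).comp ((snd _ _).pair (fst _ _))
  have hstep : CodeFP (pairE rowE (pairE bitE rowE)) (pairE bitE rowE) (fun t => pivotStep t.1 t.2) :=
    ((snd _ _).fst'.ite (snd _ _) (hh.ite ((const _ true).pair (fst _ _)) (const _ (false, [])))).congr fun t => by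
      unfold pivotStep; rfl
  refine (foldl₀ hstep (X + 4) fun l₁ l₂ => ?_).congr fun rows => rfl
  -- the accumulator is `(b, r)` with `r` an item of the list (or `[]`)
  have key : ∀ (l : List (List Bool)) (acc : Bool × List Bool), (acc.2 ∈ l₁ ++ l₂ ∨ acc.2 = []) → l ⊆ l₁ ++ l₂ →
      ((l.foldl (fun acc r => pivotStep r acc) acc).2 ∈ l₁ ++ l₂ ∨ (l.foldl (fun acc r => pivotStep r acc) acc).2 = []) := by
    intro l
    induction l with
    | nil => intro acc h _; exact h
    | cons r l ih =>
      intro acc h hsub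
      rw [List.foldl_cons]
      apply ih
      · unfold pivotStep
        split_ifs
        · exact h
        · exact Or.inl (hsub (by simp))
        · exact Or.inr rfl
      · exact fun x hx => hsub (by simp [hx])
  have h := key l₁ (false, []) (Or.inr rfl) (by simp)
  set acc := l₁.foldl (fun acc r => pivotStep r acc) (false, [])
  rw [pairE_apply, length_boolPair, eval_add, eval_X, eval_ofNat]
  simp only [bitE, List.length_singleton]
  rcases h with h | h
  · have := length_item_le_length_rawE rowE h; omega
  · rw [h]; simp

/-- **One round on codes.** [folklore] -/
theorem stepKCode : CodeFP stE stE stepK := by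
  have hpp : CodeFP stE (pairE bitE rowE) (fun st => pivotPair st.1) := pivotPairCode.comp (fst _ _)
  exact ((snd _ _).fst'.ite (CodeFP.id stE)
    (hpp.fst'.ite ((mapElimCode.comp (hpp.snd'.pair (fst _ _))).pair (const _ (false, false))) ((fst _ _).pair (const _ (true, true))))).congr
    fun st => by unfold stepK; rfl

/-- Elimination does not lengthen a row. [folklore] -/
theorem length_elimRow_le (p r : List Bool) : (elimRow p r).length ≤ r.length := by
  unfold elimRow
  split_ifs <;> simp

/-- Mapping a code-shortening function does not lengthen the raw code. [folklore] -/
theorem length_rawE_map_le {α : Type} (e : α → List Bool) {f : α → α} (hf : ∀ a, (e (f a)).length ≤ (e a).length) :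
    ∀ l : List α, (rawE e (l.map f)).length ≤ (rawE e l).length
  | [] => le_rfl
  | a :: l => by
    rw [List.map_cons, rawE_cons, rawE_cons, length_boolPair, length_boolPair]
    have := hf a; have := length_rawE_map_le e hf l; omega

/-- The rows along the loop do not lengthen. [folklore] -/
theorem length_rowsE_iterate_stepK_le (rows : List (List Bool)) :
    ∀ (k : ℕ) (st : KState), (rowsE st.1).length ≤ (rowsE rows).length → (rowsE (stepK^[k] st).1).length ≤ (rowsE rows).length
  | 0, st, h => h
  | k + 1, st, h => by
    rw [Function.iterate_succ_apply]
    apply length_rowsE_iterate_stepK_le rows k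
    unfold stepK
    split_ifs
    · exact h
    · exact (length_rawE_map_le rowE (fun r => by rw [length_rowE, length_rowE]; exact Nat.mul_le_mul_left 4 (length_elimRow_le _ r)) _).trans h
    · exact h

/-- **The program on codes**: `progK` is computed on the code of the rows by a polynomial-time string
function. [cite: AroraBarak2009, §1.3 (bounded loops)] [cite: KnuthTAOCP2, §4.6.2, Algorithm N] -/
theorem progKCode : CodeFP rowsE bitE progK := by
  have hstep : CodeFP (pairE rowsE (pairE bitE stE)) stE (fun t => stepK t.2.2) := stepKCode.comp (snd _ _).snd'
  have hinit : CodeFP rowsE stE (fun rows => (rows, (false, false))) := (CodeFP.id rowsE).pair (const _ (false, false))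
  have hfold := foldl (step := fun (_ : List (List Bool)) (_ : Bool) (st : KState) => stepK st) (init := fun rows => (rows, (false, false)))
    hstep hinit (2 * X + 7) (fun rows l₁ l₂ => by
      rw [foldl_const_eq_iterate]
      have h1 := length_rowsE_iterate_stepK_le rows l₁.length (rows, (false, false)) le_rfl
      have h2 : ∀ st : KState, (stE st).length = 2 * (rowsE st.1).length + 2 + 5 := fun st => by
        rw [show stE st = boolPair (rowsE st.1) (pairE bitE bitE st.2) from rfl, length_boolPair]
        simp [bitE, length_boolPair]
      rw [h2, pairE_apply, length_boolPair, eval_add, eval_mul, eval_ofNat, eval_X, eval_ofNat]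
      dsimp only
      omega)
  have hhead : CodeFP rowsE rowE (fun rows => rows.headD []) := rawHeadD rowE (d := []) rfl
  have hrun : CodeFP rowsE stE (fun rows => (rows.headD []).foldl (fun st _ => stepK st) (rows, (false, false))) :=
    (hfold.comp ((CodeFP.id rowsE).pair hhead)).congr fun _ => rfl
  exact (hrun.snd'.fst'.and hrun.snd'.snd').congr fun rows => rfl

end Program

end GF2Kernel

end Literature.Computability.Complexity
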